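import Literature.NumberTheory.IwasawaTheory.ClassGroupCoinvariantGenusCriterion
import Literature.NumberTheory.IwasawaTheory.ClassicalLambdaLeStableRank
import Literature.NumberTheory.NumberFields.ClassGroupNormGalois
import HarnessLib

/-!
# NO CAPITULATION ⟹ `e_{n+1} − e_n ≥ rank_p Cl(K_n)` ⟹ `λ ≥` the eventual `p`-rank: the LOWER half of «`λ = rank` when the Iwasawa module
# has no finite submodule», at finite level (Washington Prop. 13.26/13.28 bookkeeping; no definition, no named fact)

Topic `NumberTheory/IwasawaTheory` (namespace = path).  THEOREM-ONLY file, written by the prover seat `bsd-line-att-p3` g31 (cell `bsd-f1-sign2`;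
`--supports` stmt-BirchSwinnertonDyer-22298; closes nothing; no class group is computed here).  Companion of `ClassicalLambdaLeStableRank.lean` (seat
g28: `λ ≤ rank_p Cl(K_m)` for `m ≫ 0`, every `ℤ_p`-extension) — here the opposite inequality under the hypothesis that the extension (capitulation) maps
`Cl(K_m) → Cl(K_{m+1})` are injective.

THE ALGEBRA (§1).  `N : B ↠ A` and `j : A ↪ B` homomorphisms of finite commutative groups, `(g_i)_{i ∈ ι}` a finite family of endomorphisms of `B` with
`N ∘ g_i = N` and `j (N b) = ∏_i g_i b`, and `d ∣ #ι`.  Then **`#A · #(A/A^d) ∣ #B`**: the image of `j ∘ N` has order `#A` (`j` injective, `N` onto) and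
lies in `B^d · I` (`I = ⟨g_i b / b⟩`, since `∏_i g_i b = b^{#ι} · ∏_i (g_i b / b)`), while `B/(B^d · I) ↠ A/A^d` (`N` kills `I` and maps `B^d` into `A^d`),
so `#(A/A^d) ∣ [B : B^d · I]`; multiply (`#B = #(B^d·I) · [B : B^d·I]`).  With `d = p`: `ord_p #A + rank_p A ≤ ord_p #B`.

THE TOWER (§2).  `κ : K_∞/K` a `ℤ_p`-extension of a number field with Fukuda index `n₀` (`TotallyRamifiedFrom κ n₀`), layers `M = K_{n+1} ⊆ L = K_{n+2}`,
`n ≥ n₀`, with the inclusion algebra structure.  `N_{L/M}` is onto (tree `classGroupNorm_layer_succ_succ_surjective`), `Gal(L/M)` has order `p`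
(`card_aut_layer_layer`), `i_{L/M}(N_{L/M} c) = ∏_σ σ • c` (Neukirch III (1.6) (iv), tree `classGroupExtend_classGroupNorm_eq_prod`) and `N(σ • c) = N c`
(tree `classGroupNorm_galois_smul`).  Hence ★ `classNumberPExp_add_classGroupPRank_le_of_classGroupExtend_injective`:
**`i_{L/M}` injective ⟹ `e_{n+1} + r_{n+1} ≤ e_{n+2}`** (`e_m = ord_p h(K_m)`, `r_m = rank_p Cl(K_m)`).

`λ` (§3).  Under `μ = 0` the differences `e_{m+1} − e_m` are eventually `λ` (tree `classNumberPExp_succ_sub_eq_classicalLambda`), so ★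
`classicalLambda_ge_classGroupPRank_of_classGroupExtend_injective`: **`μ = 0`, Fukuda index `n₀`, `i_{K_{n+2}/K_{n+1}}` injective for all `n ≥ n₁` ⟹
`rank_p Cl(K_m) ≤ classicalLambda κ` for every `m ≥ max(n₀, n₁) + 1` large enough** and, with the tree's unconditional `λ ≤ r_m` (`m ≫ 0`),
★ `classicalLambda_eq_classGroupPRank_of_classGroupExtend_injective`: **`λ = rank_p Cl(K_m)` for all `m ≫ 0`**.

Structure-theory reading (orientation only, NOT used): injective transition maps `A_n → A_m` force `X = lim_← A_n` to have no non-zero finite `Λ`-submodule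
(Washington Prop. 13.28), so under `μ = 0` it is `ℤ_p`-free of rank `λ = dim_{𝔽_p} X/pX = lim rank_p A_n`.  Used by the sequel
`ImaginaryQuadraticTwoTowerNoCapitulation.lean` (no capitulation in the cyclotomic `ℤ₂`-tower of an imaginary quadratic field with odd discriminant:
the lower half of Ferrero's / Kida's `λ₂ = Σ_{ℓ ∣ d} 2^{ord₂(ℓ²−1)−3} − 1`).  Not found in print in this finite form (presearch: corpus Lang 1990 Ch. 5,
Washington §13.3 via secondary sources; galaxy none) — ingredients cited at each use (D-0014: our proof assembled from cited ingredients).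

References: [Washington1997] §13.3 Prop. 13.22–13.28, Thm. 13.13; [NeukirchANT1999] Ch. III §1 Prop. (1.6) (ii), (iv); [Lang1990] Ch. 5 §1 Thm. 1.2,
Ch. 13 §4; [Fukuda1994] p. 264 (the index `n₀`).
-/

set_option autoImplicit false

noncomputable section

open scoped NumberField

/-! ## §1 Finite commutative groups: `#A · #(A/A^d) ∣ #B` -/

namespace Literature.NumberTheory.IwasawaTheory.NoCapitulation

section Algebra

variable {A B : Type*} [CommGroup A] [Finite A] [CommGroup B] [Finite B]

omit [Finite B] in
/-- `∏_i g_i b = b^{#ι} · ∏_i (g_i b / b)` in a commutative group. [folklore] -/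
private theorem prod_apply_eq_pow_mul_prod_div {ι : Type*} [Fintype ι] (g : ι → B →* B) (b : B) :
    ∏ i, g i b = b ^ Fintype.card ι * ∏ i, (g i b / b) := by
  have hb : b ^ Fintype.card ι = ∏ _i : ι, b := by rw [Finset.prod_const, Finset.card_univ]
  rw [hb, ← Finset.prod_mul_distrib]
  exact Finset.prod_congr rfl fun i _ => by rw [mul_comm, div_mul_cancel]

omit [Finite A] [Finite B] in
/-- A surjection of groups induces a surjection `B/H ↠ A/H'` whenever `H ≤ f⁻¹ H'`; hence `#(A/H') ∣ #(B/H)` for finite groups, in the form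
`#(A ⧸ H') ∣ H.index`. [folklore] -/
private theorem card_quotient_dvd_index_of_le_comap (f : B →* A) (hf : Function.Surjective f) (H : Subgroup B) (H' : Subgroup A)
    (hle : H ≤ H'.comap f) : Nat.card (A ⧸ H') ∣ H.index := by
  -- the composite `B → A → A/H'` is onto with kernel `⊇ H`
  set φ : B →* A ⧸ H' := (QuotientGroup.mk' H').comp f with hφ
  have hφs : Function.Surjective φ := (QuotientGroup.mk'_surjective H').comp hf
  have hker : H ≤ φ.ker := fun b hb => by
    rw [MonoidHom.mem_ker, hφ, MonoidHom.comp_apply, QuotientGroup.mk'_apply, QuotientGroup.eq_one_iff]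
    exact hle hb
  have h1 : φ.ker.index = Nat.card (A ⧸ H') := by
    rw [Subgroup.index_ker, MonoidHom.range_eq_top.mpr hφs, Subgroup.card_top]
  rw [← h1]
  exact Subgroup.index_dvd_of_le hker

omit [Finite A] [Finite B] in
/-- ★ **`#A · #(A/A^d) ∣ #B`.**  `N : B → A` onto, `j : A → B` injective, `g_i` (`i ∈ ι`, finite) endomorphisms of `B` with `N (g_i b) = N b` and
`j (N b) = ∏_i g_i b`, `d ∣ #ι`.  Then `#A · #(A ⧸ A^d) ∣ #B` (`A^d` = range of the `d`-th power map).  Proof in the module docstring: `im(j∘N) ≤ B^d·I`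
has order `#A`, and `B/(B^d·I) ↠ A/A^d`. [cite: Washington1997, §13.3 (proof of Prop. 13.22–13.23)] [cite: NeukirchANT1999, Ch. III §1 Prop. (1.6) (ii), (iv)] -/
theorem card_mul_card_quotient_dvd_card {ι : Type*} [Fintype ι] (N : B →* A) (j : A →* B) (g : ι → B →* B) {d : ℕ}
    (hN : Function.Surjective N) (hj : Function.Injective j) (hNg : ∀ i b, N (g i b) = N b) (hjN : ∀ b, j (N b) = ∏ i, g i b)
    (hd : d ∣ Fintype.card ι) :
    Nat.card A * Nat.card (A ⧸ (powMonoidHom d : A →* A).range) ∣ Nat.card B := by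
  classical
  set I : Subgroup B := Subgroup.closure {x | ∃ (i : ι) (b : B), x = g i b / b} with hI
  set H : Subgroup B := (powMonoidHom d : B →* B).range ⊔ I with hH
  -- (1) `range (j ∘ N) ≤ H`
  have hrange : (j.comp N).range ≤ H := by
    rintro _ ⟨b, rfl⟩
    rw [MonoidHom.comp_apply, hjN b, prod_apply_eq_pow_mul_prod_div g b]
    obtain ⟨m, hm⟩ := hd
    refine Subgroup.mul_mem _ (Subgroup.mem_sup_left ⟨b ^ m, ?_⟩) (Subgroup.mem_sup_right ?_)
    · rw [powMonoidHom_apply, ← pow_mul, mul_comm, ← hm]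
    · exact Subgroup.prod_mem _ fun i _ => Subgroup.subset_closure ⟨i, b, rfl⟩
  -- (2) `#range (j ∘ N) = #A`
  have hcardr : Nat.card (j.comp N).range = Nat.card A := by
    rw [MonoidHom.range_comp, MonoidHom.range_eq_top.mpr hN, ← MonoidHom.range_eq_map]
    exact Nat.card_congr (j.ofInjective hj).toEquiv.symm
  have hA : Nat.card A ∣ Nat.card H := by
    rw [← hcardr]
    exact Subgroup.card_dvd_of_le hrange
  -- (3) `#(A/A^d) ∣ [B : H]`
  have hq : Nat.card (A ⧸ (powMonoidHom d : A →* A).range) ∣ H.index := by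
    refine card_quotient_dvd_index_of_le_comap N hN H _ (sup_le ?_ ?_)
    · rintro _ ⟨b, rfl⟩
      exact ⟨N b, by rw [powMonoidHom_apply, powMonoidHom_apply, map_pow]⟩
    · rw [hI, Subgroup.closure_le]
      rintro _ ⟨i, b, rfl⟩
      simp only [SetLike.mem_coe, Subgroup.mem_comap, map_div, hNg i b, div_self']
      exact one_mem _
  -- (4) multiply
  rw [← Subgroup.card_mul_index H]
  exact mul_dvd_mul hA hq

/-- The `p`-adic reading: under the hypotheses of `card_mul_card_quotient_dvd_card` with `d = p` prime,
**`ord_p #A + ord_p #(A/A^p) ≤ ord_p #B`** (`ord_p #(A/A^p) = rank_p A`). [cite: Washington1997, §13.3 (proof of Prop. 13.23)] -/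
theorem padicValNat_card_add_le {ι : Type*} [Fintype ι] {p : ℕ} [hp : Fact p.Prime] (N : B →* A) (j : A →* B) (g : ι → B →* B)
    (hN : Function.Surjective N) (hj : Function.Injective j) (hNg : ∀ i b, N (g i b) = N b) (hjN : ∀ b, j (N b) = ∏ i, g i b)
    (hd : p ∣ Fintype.card ι) :
    padicValNat p (Nat.card A) + padicValNat p (Nat.card (A ⧸ (powMonoidHom p : A →* A).range)) ≤ padicValNat p (Nat.card B) := by
  have h := card_mul_card_quotient_dvd_card N j g hN hj hNg hjN hd
  have hA : Nat.card A ≠ 0 := Nat.card_pos.ne'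
  have hQ : Nat.card (A ⧸ (powMonoidHom p : A →* A).range) ≠ 0 := Nat.card_pos.ne'
  have hB : Nat.card B ≠ 0 := Nat.card_pos.ne'
  rw [← padicValNat.mul hA hQ]
  exact (padicValNat_dvd_iff_le hB).mp (dvd_trans pow_padicValNat_dvd h)

end Algebra

end Literature.NumberTheory.IwasawaTheory.NoCapitulation

/-! ## §2 The tower: `i_{K_{n+2}/K_{n+1}}` injective ⟹ `e_{n+1} + r_{n+1} ≤ e_{n+2}` -/

namespace Literature.NumberTheory.IwasawaTheory

open NumberField Literature.NumberTheory.EllipticCurves Literature.NumberTheory.NumberFields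

variable {K : Type} [Field K] [NumberField K] {p : ℕ} [hp : Fact p.Prime]

/-- ★ **No capitulation at a layer pair forces growth: `e_{n+1} + rank_p Cl(K_{n+1}) ≤ e_{n+2}`.**  `κ` a `ℤ_p`-extension of the number field `K` with
`TotallyRamifiedFrom κ n₀`, `n ≥ n₀`, `M = K_{n+1} ⊆ L = K_{n+2}` with the inclusion algebra structure; if `i_{L/M} : Cl(M) → Cl(L)` is injective then
`ord_p h(M) + rank_p Cl(M) ≤ ord_p h(L)`.  (`N_{L/M}` onto above the Fukuda index; `#Gal(L/M) = p`; `i ∘ N = Σ_σ σ`; §1.)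
[cite: Washington1997, §13.3 Prop. 13.22–13.23] [cite: NeukirchANT1999, Ch. III §1 Prop. (1.6) (ii), (iv)] [cite: Fukuda1994, p. 264] -/
theorem classNumberPExp_add_classGroupPRank_le_of_classGroupExtend_injective (κ : ZpExtension K p) {n₀ n : ℕ}
    (hκ : TotallyRamifiedFrom κ n₀) (hn : n₀ ≤ n) [NumberField (κ.layer (n + 1))] [NumberField (κ.layer (n + (1 + 1)))]
    (hinj : letI : Algebra (κ.layer (n + 1)) (κ.layer (n + (1 + 1))) :=
        (IntermediateField.inclusion (κ.layer_mono (by omega))).toRingHom.toAlgebra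
      Function.Injective (classGroupExtend (κ.layer (n + 1)) (κ.layer (n + (1 + 1))))) :
    classNumberPExp κ (n + 1) + classGroupPRank κ (n + 1) ≤ classNumberPExp κ (n + 2) := by
  classical
  set M := κ.layer (n + 1)
  set L := κ.layer (n + (1 + 1))
  have hML : κ.layer (n + 1) ≤ κ.layer (n + (1 + 1)) := κ.layer_mono (by omega)
  letI : Algebra M L := (IntermediateField.inclusion hML).toRingHom.toAlgebra
  haveI : IsScalarTower K M L := IsScalarTower.of_algebraMap_eq fun x => ((IntermediateField.inclusion hML).commutes x).symm
  haveI : FiniteDimensional K M := κ.finiteDimensional_layer_holds _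
  haveI : FiniteDimensional K L := κ.finiteDimensional_layer_holds _
  haveI : FiniteDimensional M L := Module.Finite.of_restrictScalars_finite K M L
  haveI : IsGalois M L := isGalois_layer_layer κ
  -- the norm is onto above the Fukuda index
  have hN : Function.Surjective (classGroupNorm M L) := classGroupNorm_layer_succ_succ_surjective κ (hκ.mono hn)
  -- `#Gal(L/M) = p`
  have hcard : Fintype.card (L ≃ₐ[M] L) = p := by
    rw [← Nat.card_eq_fintype_card, card_aut_layer_layer κ (show n + 1 ≤ n + (1 + 1) by omega)]
    simp
  have h := NoCapitulation.padicValNat_card_add_le (p := p) (classGroupNorm M L) (classGroupExtend M L)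
    (fun σ : L ≃ₐ[M] L => (ClassGroup.mulEquiv (AmbiguousClass.intAut σ)).toMonoidHom) hN hinj
    (fun σ c => classGroupNorm_galois_smul M L σ c) (fun c => classGroupExtend_classGroupNorm_eq_prod M L c) (by rw [hcard])
  rw [classNumberPExp_def, classNumberPExp_def, classGroupPRank_def]
  exact h

/-! ## §3 `λ ≥ rank_p Cl(K_m)` eventually, and `λ = rank_p Cl(K_m)` for `m ≫ 0` -/

/-- ★ **NO CAPITULATION ⟹ `λ ≥` the eventual `p`-rank.**  `κ` with `μ = 0` (`ClassicalMuVanishes κ`) and Fukuda index `n₀`; if the extension maps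
`i : Cl(K_{n+1}) → Cl(K_{n+2})` are injective for all `n ≥ n₁` with `n ≥ n₀`, then there is `m₀` with **`rank_p Cl(K_m) ≤ classicalLambda κ` for all
`m ≥ m₀`**: `e_{m+1} − e_m = λ` for `m ≫ 0` (tree `classNumberPExp_succ_sub_eq_classicalLambda`) and `e_{m+1} − e_m ≥ r_m` (§2).
[cite: Washington1997, §13.3 Thm. 13.13 and Prop. 13.28] [cite: Fukuda1994, p. 264] -/
theorem exists_forall_classGroupPRank_le_classicalLambda_of_classGroupExtend_injective (κ : ZpExtension K p) {n₀ n₁ : ℕ}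
    (hκ : TotallyRamifiedFrom κ n₀) (hμ : ClassicalMuVanishes κ)
    (hinj : ∀ n, n₀ ≤ n → n₁ ≤ n → ∀ [NumberField (κ.layer (n + 1))] [NumberField (κ.layer (n + (1 + 1)))],
      letI : Algebra (κ.layer (n + 1)) (κ.layer (n + (1 + 1))) :=
        (IntermediateField.inclusion (κ.layer_mono (by omega))).toRingHom.toAlgebra
      Function.Injective (classGroupExtend (κ.layer (n + 1)) (κ.layer (n + (1 + 1))))) :
    ∃ m₀ : ℕ, ∀ m, m₀ ≤ m → classGroupPRank κ m ≤ classicalLambda κ := by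
  obtain ⟨n₂, hn₂⟩ := classNumberPExp_succ_sub_eq_classicalLambda κ hμ
  refine ⟨max (max n₀ n₁) n₂ + 1, fun m hm => ?_⟩
  obtain ⟨n, rfl⟩ : ∃ n, m = n + 1 := ⟨m - 1, by omega⟩
  haveI : FiniteDimensional K (κ.layer (n + 1)) := κ.finiteDimensional_layer_holds _
  haveI : NumberField (κ.layer (n + 1)) := NumberField.of_module_finite K _
  haveI : FiniteDimensional K (κ.layer (n + (1 + 1))) := κ.finiteDimensional_layer_holds _
  haveI : NumberField (κ.layer (n + (1 + 1))) := NumberField.of_module_finite K _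
  have h1 := classNumberPExp_add_classGroupPRank_le_of_classGroupExtend_injective κ hκ (by omega) (hinj n (by omega) (by omega))
  have h2 := hn₂ (n + 1) (by omega)
  have h3 : (classNumberPExp κ (n + 1) : ℤ) + classGroupPRank κ (n + 1) ≤ classNumberPExp κ (n + 1 + 1) := by exact_mod_cast h1
  have h4 : (classGroupPRank κ (n + 1) : ℤ) ≤ classicalLambda κ := by linarith
  exact_mod_cast h4

/-- ★ **NO CAPITULATION ⟹ `λ = rank_p Cl(K_m)` for all `m ≫ 0`.**  Same hypotheses; the tree's unconditional `λ ≤ rank_p Cl(K_m)` (`m ≫ 0`,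
`exists_forall_classicalLambda_le_classGroupPRank`) gives the other inequality.  (Structure theory: `X` has no finite submodule, so
`λ = dim_{𝔽_p} X/pX`.) [cite: Washington1997, §13.3 Thm. 13.13, Prop. 13.23 and Prop. 13.28] -/
theorem exists_forall_classicalLambda_eq_classGroupPRank_of_classGroupExtend_injective (κ : ZpExtension K p) {n₀ n₁ : ℕ}
    (hκ : TotallyRamifiedFrom κ n₀) (hμ : ClassicalMuVanishes κ)
    (hinj : ∀ n, n₀ ≤ n → n₁ ≤ n → ∀ [NumberField (κ.layer (n + 1))] [NumberField (κ.layer (n + (1 + 1)))],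
      letI : Algebra (κ.layer (n + 1)) (κ.layer (n + (1 + 1))) :=
        (IntermediateField.inclusion (κ.layer_mono (by omega))).toRingHom.toAlgebra
      Function.Injective (classGroupExtend (κ.layer (n + 1)) (κ.layer (n + (1 + 1))))) :
    ∃ m₀ : ℕ, ∀ m, m₀ ≤ m → classicalLambda κ = classGroupPRank κ m := by
  obtain ⟨a, ha⟩ := exists_forall_classGroupPRank_le_classicalLambda_of_classGroupExtend_injective κ hκ hμ hinj
  obtain ⟨b, hb⟩ := exists_forall_classicalLambda_le_classGroupPRank κ
  exact ⟨max a b, fun m hm => le_antisymm (hb m ((le_max_right a b).trans hm)) (ha m ((le_max_left a b).trans hm))⟩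

/-- **Pinning `λ` by a rank value under no capitulation**: if moreover `rank_p Cl(K_m) = r` for all `m ≥ m₁`, then **`classicalLambda κ = r`**.
[cite: Washington1997, §13.3 Thm. 13.13 and Prop. 13.28] -/
theorem classicalLambda_eq_of_classGroupExtend_injective_of_classGroupPRank_eq (κ : ZpExtension K p) {n₀ n₁ : ℕ}
    (hκ : TotallyRamifiedFrom κ n₀) (hμ : ClassicalMuVanishes κ)
    (hinj : ∀ n, n₀ ≤ n → n₁ ≤ n → ∀ [NumberField (κ.layer (n + 1))] [NumberField (κ.layer (n + (1 + 1)))],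
      letI : Algebra (κ.layer (n + 1)) (κ.layer (n + (1 + 1))) :=
        (IntermediateField.inclusion (κ.layer_mono (by omega))).toRingHom.toAlgebra
      Function.Injective (classGroupExtend (κ.layer (n + 1)) (κ.layer (n + (1 + 1)))))
    {r m₁ : ℕ} (hr : ∀ m, m₁ ≤ m → classGroupPRank κ m = r) : classicalLambda κ = r := by
  obtain ⟨m₀, h⟩ := exists_forall_classicalLambda_eq_classGroupPRank_of_classGroupExtend_injective κ hκ hμ hinj
  rw [h (max m₀ m₁) (le_max_left _ _), hr (max m₀ m₁) (le_max_right _ _)]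

end Literature.NumberTheory.IwasawaTheory

end
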